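import Summits.CriticalPhenomena.PercolationContinuityZ3.Theorems.SahiMasterFamilyStructRemoval

/-!
# Tight structured families: canonical frames are the principal filters of the cores (TIGHTNESS-II (D1), first half)

Unit `prim-master-conj` (crux anchor stmt-CriticalPhenomena-4575), gen 11; memos HOME/prim-master-conj/TIGHTNESS-II.md §2.2 (gen 10) and
TIGHTNESS-III.md §3 (gen 11: the one remaining Lean debt for (EQI-4) is `FrameFieldDisjoint`, whose doubly-tight branch starts here).
A structured family (`Structured`, gen 6) is TIGHT if its common part is the top configuration alone: `⋂_w U w = {univ}`.  Then
(all orders, all index types):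
* `mem_of_cfail_card_le_one` — T″ in canonical form: a configuration failing at most one canonical frame lies in every member whose frame
  contains it;
* **`cframe_eq_principal_of_tight`** — every canonical frame is the principal filter `{ω | esupp (cframe) ⊆ ω}` of its own block;
* **`exists_mem_esupp_cframe_of_tight`** — the blocks cover all coordinates;
* **`mem_esupp_cframe_iff_core`** — the block of `w` is exactly the CORE of `U w` (the coordinates lying in every configuration of `U w`);
  hence the cores of a tight structured family partition the coordinates and determine the frames.
Pure combinatorics; axioms standard. [this work]
-/

noncomputable section

open scoped Classical

namespace Summit.CriticalPhenomena.PercolationContinuityZ3.Theorems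

namespace TightFrames

open Finset Function
open Literature.Probability.LatticeModels.Kahn2022 (Affects)

variable {ι : Type*} [Fintype ι] {κ : Type*} (U : κ → Set (Set ι))

/-- **T″, canonical form**: in a structured family, a configuration failing the canonical frames of at most one member lies in every member
whose canonical frame contains it. [this work] -/
theorem mem_of_cfail_card_le_one (hU : ∀ k, IsUpperSet (U k)) (hne : ∀ k, (U k).Nonempty) {W : Finset κ} (hW : Structured U W)
    {φ : Set ι} (h1 : (cfail U W φ).card ≤ 1) {w : κ} (hw : w ∈ W) (hφ : φ ∈ cframe U W w) : φ ∈ U w := by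
  obtain ⟨l, hlW, hl⟩ := hW
  subst hlW
  have hwl : w ∈ l := List.mem_toFinset.1 hw
  refine mem_of_frameFail_card_le_one U hl hU (φ := φ) ?_ hwl (by rw [frameIn_eq_cframe U hU hne hl hwl]; exact hφ)
  rw [frameFail_eq_cfail U hU hne hl φ]; exact h1

/-- A configuration containing the essential support of a non-empty increasing event lies in it. [folklore] -/
theorem mem_of_esupp_subset {A : Set (Set ι)} (hA : IsUpperSet A) (hne : A.Nonempty) {ω : Set ι} (h : ↑(esupp A) ⊆ ω) : ω ∈ A := by
  refine (mem_iff_of_inter_esupp_eq hA (ω := ω) (ω' := Set.univ) ?_).2 (univ_mem_of_nonempty hA hne)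
  rw [Set.univ_inter, Set.inter_eq_right.2 h]

variable {U}

/-- **In a tight structured family every canonical frame is the principal filter of its block.** [this work] -/
theorem cframe_eq_principal_of_tight (hU : ∀ k, IsUpperSet (U k)) (hne : ∀ k, (U k).Nonempty) {W : Finset κ} (hW : Structured U W)
    (htight : (⋂ w ∈ W, U w) = {Set.univ}) {w : κ} (hw : w ∈ W) :
    cframe U W w = {ω | (↑(esupp (cframe U W w)) : Set ι) ⊆ ω} := by
  have hAup : ∀ x, IsUpperSet (cframe U W x) := fun x => isUpperSet_cframe U hU W x
  have hAne : ∀ x, (cframe U W x).Nonempty := fun x => ⟨_, subset_cframe U hU W x (univ_mem_of_nonempty (hU x) (hne x))⟩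
  ext ω
  constructor
  · intro hω
    -- enlarge `ω` outside the block: the result lies in every frame, hence is `univ`
    set ω' : Set ι := ω ∪ {x | x ∉ esupp (cframe U W w)} with hω'def
    have hω'w : ω' ∈ cframe U W w := hAup w Set.subset_union_left hω
    have hω'all : ∀ x ∈ W, ω' ∈ cframe U W x := by
      intro x hx
      by_cases hxw : x = w
      · subst hxw; exact hω'w
      · refine mem_of_esupp_subset (hAup x) (hAne x) fun y hy => Or.inr fun hyw => ?_
        exact Finset.disjoint_left.1 (disjoint_esupp_cframe U hU hne hW hx hw hxw) (mem_coe.1 hy) hyw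
    have hω'cap : ω' ∈ ⋂ x ∈ W, U x := by
      rw [biInter_eq_biInter_cframe U hU hne hW]; exact Set.mem_iInter₂.2 hω'all
    rw [htight, Set.mem_singleton_iff] at hω'cap
    intro y hy
    have : y ∈ ω' := by rw [hω'cap]; exact Set.mem_univ y
    rcases this with h | h
    · exact h
    · exact absurd (mem_coe.1 hy) h
  · intro hω; exact mem_of_esupp_subset (hAup w) (hAne w) hω

/-- **The blocks of a tight structured family cover every coordinate.** [this work] -/
theorem exists_mem_esupp_cframe_of_tight (hU : ∀ k, IsUpperSet (U k)) (hne : ∀ k, (U k).Nonempty) {W : Finset κ} (hW : Structured U W)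
    (htight : (⋂ w ∈ W, U w) = {Set.univ}) (x : ι) : ∃ w ∈ W, x ∈ esupp (cframe U W w) := by
  by_contra hnone
  push Not at hnone
  have hmem : Set.univ \ {x} ∈ ⋂ w ∈ W, U w := by
    rw [biInter_eq_biInter_cframe U hU hne hW]
    refine Set.mem_iInter₂.2 fun w hw => ?_
    have huniv : Set.univ ∈ cframe U W w :=
      univ_mem_of_nonempty (isUpperSet_cframe U hU W w) ⟨_, subset_cframe U hU W w (univ_mem_of_nonempty (hU w) (hne w))⟩
    refine (insert_mem_iff_of_not_affects (isUpperSet_cframe U hU W w) (fun h => hnone w hw (mem_esupp.2 h)) _).1 ?_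
    rwa [Set.insert_sdiff_singleton, Set.insert_eq_of_mem (Set.mem_univ x)]
  rw [htight, Set.mem_singleton_iff] at hmem
  have : x ∈ Set.univ \ {x} := by rw [hmem]; exact Set.mem_univ x
  exact this.2 rfl

/-- **Blocks are cores**: in a tight structured family, `x` lies in the block of `w` iff `x` lies in every configuration of `U w`. [this work] -/
theorem mem_esupp_cframe_iff_core (hU : ∀ k, IsUpperSet (U k)) (hne : ∀ k, (U k).Nonempty) {W : Finset κ} (hW : Structured U W)
    (htight : (⋂ w ∈ W, U w) = {Set.univ}) {w : κ} (hw : w ∈ W) (x : ι) :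
    x ∈ esupp (cframe U W w) ↔ ∀ ω ∈ U w, x ∈ ω := by
  constructor
  · intro hx ω hω
    have := subset_cframe U hU W w hω
    rw [cframe_eq_principal_of_tight hU hne hW htight hw] at this
    exact this (mem_coe.2 hx)
  · intro hcore
    obtain ⟨w', hw', hx'⟩ := exists_mem_esupp_cframe_of_tight hU hne hW htight x
    by_cases hww : w' = w
    · exact hww ▸ hx'
    · -- `univ ∖ {x}` fails only the frame of `w'`, hence lies in `U w` — contradicting the core
      exfalso
      have hφ : ∀ v ∈ W, v ≠ w' → Set.univ \ {x} ∈ cframe U W v := by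
        intro v hv hvw'
        rw [cframe_eq_principal_of_tight hU hne hW htight hv]
        intro y hy
        refine ⟨Set.mem_univ y, fun hyx => ?_⟩
        rw [Set.mem_singleton_iff] at hyx; subst hyx
        exact Finset.disjoint_left.1 (disjoint_esupp_cframe U hU hne hW hv hw' hvw') (mem_coe.1 hy) hx'
      have h1 : (cfail U W (Set.univ \ {x})).card ≤ 1 := by
        refine card_le_one.2 fun a ha b hb => ?_
        rw [mem_cfail] at ha hb
        have ha' : a = w' := by by_contra h; exact ha.2 (hφ a ha.1 h)
        have hb' : b = w' := by by_contra h; exact hb.2 (hφ b hb.1 h)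
        rw [ha', hb']
      have := mem_of_cfail_card_le_one U hU hne hW h1 hw (hφ w hw (Ne.symm hww))
      exact (hcore _ this).2 rfl

/-- Hence the cores of two distinct members of a tight structured family are disjoint. [this work] -/
theorem core_disjoint_of_tight (hU : ∀ k, IsUpperSet (U k)) (hne : ∀ k, (U k).Nonempty) {W : Finset κ} (hW : Structured U W)
    (htight : (⋂ w ∈ W, U w) = {Set.univ}) {w w' : κ} (hw : w ∈ W) (hw' : w' ∈ W) (hww : w ≠ w') {x : ι}
    (hx : ∀ ω ∈ U w, x ∈ ω) (hx' : ∀ ω ∈ U w', x ∈ ω) : False :=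
  Finset.disjoint_left.1 (disjoint_esupp_cframe U hU hne hW hw hw' hww)
    ((mem_esupp_cframe_iff_core hU hne hW htight hw x).2 hx) ((mem_esupp_cframe_iff_core hU hne hW htight hw' x).2 hx')

end TightFrames

end Summit.CriticalPhenomena.PercolationContinuityZ3.Theorems
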